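import Summits.BirchSwinnertonDyer.BirchSwinnertonDyer.Theorems.SignedLowerHalvesSmallImageLowerHalfBothSignsRttD2SeqJ3RGlobal
import Summits.BirchSwinnertonDyer.BirchSwinnertonDyer.Theorems.SignedLowerHalvesSmallImageLowerHalfBothSignsRttD2SeqJ3RInflation
import Summits.BirchSwinnertonDyer.BirchSwinnertonDyer.Theorems.SignedLowerHalvesSmallImageLowerHalfBothSignsRttD2SeqJ3RTorsion
import Summits.BirchSwinnertonDyer.BirchSwinnertonDyer.Theorems.SignedLowerHalvesSmallImageLowerHalfBothSignsRttD2SeqJ3Strict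
import Summits.BirchSwinnertonDyer.BirchSwinnertonDyer.Theorems.SignedLowerHalvesSmallImageLowerHalfBothSignsRttD2SeqJ3LayerPairingOf
import HarnessLib

/-!
# Route `SignedLowerHalves`, crux L `SmallImageLowerHalfBothSigns` (stmt-BirchSwinnertonDyer-23599), line `rtt_w3` v15 — E2, row J3 residual:
# ★★★ THE LEVELWISE RECIPROCITY `RSeq` (binder of `exists_junction_exact_of_levelwiseSeq`, p791963, VERBATIM SHAPE) PROVED for coefficient pairings
# that are restrictions to `Γ_{K_v}` of a GLOBAL `Γ_K`-pairing family `PG_k : X_k × M[p^k] → μ_{p^k}`, over a TOTALLY COMPLEX `K`, at the unique place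
# `v` above `p` (non-split in `K_∞`), when `P ∖ S₀ ⊆ {v}` and inertia off `P` acts trivially on `M`

WIDTH seat `bsd-line-slh-p3-w3` g23 under LEAD `cruxlead-stmt-BirchSwinnertonDyer-23599` g11 (cell `bsd-ssimc`); helper `--supports stmt-BirchSwinnertonDyer-23599`.
THEOREMS ONLY; no definition, no named fact, no instance, no `sorry`. HONEST FRAMING: this discharges ONE of the two remaining mathematical inputs of J3 (g22's
`exists_junction_exact_of_levelwiseSeq` / `exists_junction_exact_cofree_lam_seq`, p791963 / p792377): the levelwise Poitou–Tate RECIPROCITY `RSeq`, from Tate's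
reciprocity law PROVED in the tree (`sumInvLocalizationEqZero_canonical_of_numberField` → the Shapiro-model levelwise core → R1–R5 of this seat). The other input
`hsolL` (levelwise Poitou–Tate SOLVABILITY/exactness) remains OPEN. E2, crux L, crux M, BSD remain OPEN and are proved for NO curve.

THE ARGUMENT (`locPairNK_eq_zero_of_globalPairing`). Fix a layer `n`, a `k`-compatible S₀-strict family `y = (y_k)`, `c ∈ Sel^{ε,S₀}_𝒪(K_n, M)`, and a local lift
`ℓ ∈ H¹(U_{n,v}, M[p^k])` of `loc_{v,n} c`. (1) LIFT (R5): for some `k′ ≥ k`, `torsIncl ℓ = θ_{U_n,v}^* b` for a GLOBAL `b ∈ H¹(U_n, M[p^{k′}])` lifting `c`; by the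
red⊣incl law (g22 `locPairNK_cycRedLE`) and `y_k = cycRedLE y_{k′}`, `⟨y_k, ℓ⟩_{n,k} = ⟨y_{k′}, θ^* b⟩_{n,k′}`. (2) `⟨y_{k′}, θ^* b⟩_{n,k′} = inv_{U_{n,v}}(loc_{n,v} y_{k′} ∪ θ^* b)`
(`pairLoc` = tree `localPairingSubgroup`) with `loc_{n,v} = θ_{U_n,v}^* ∘ infl_n` (R4). (3) RECIPROCITY (R3) for `a = infl_n y_{k′}`, `b`, `T = P ∪ S₀ ∪ {v}`: `a` dies on inertia off
`P` (R4), `b` dies on inertia off `T` (R5: `c` unramified off `S₀ ∪ {p}`, inertia off `P` trivial on `M`, `v` the only place above `p`), `K` totally complex, `v` non-split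
(one orbit), and every orbit term at `w ∈ T ∖ {v} ⊆ S₀` vanishes because `y_{k′}` is S₀-STRICT (`locNK_w(conj_g y_{k′}) = 0`, R4 `conjMap_inflNK`). Hence the `v`-term is `0`.

* `quotientMapOfHom_surjective_of_isNonsplitIn` (one orbit at `v`), `eq_cycRedLE_of_forall_red` (compatible families are `cycRedLE`-towers),
  ★★★ `locPairNK_eq_zero_of_globalPairing` — `RSeq` for `Pk k := resPairingAt K (p^k) (coeffRepK S θ′ P k) (torsRep M hstabK p k) (PG k) v`.
References: [NeukirchSchmidtWingberg2008] VIII §6 (Poitou–Tate), I §5–§6; [MilneADT2006] I Thm. 4.10 (b); [Rubin2000] Thm. 1.7.3, §4.2; [Kobayashi2003] Thm. 7.3 i);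
[Kato2004Asterisque] §17.13; [CasselsFrohlichANT1967] VII §11.
-/

set_option autoImplicit false
set_option linter.dupNamespace false -- D-0017: single-problem summit, the namespace repeats the problem name by design
noncomputable section

open scoped Classical
open NumberField IsDedekindDomain Field CategoryTheory Function

namespace Summit.BirchSwinnertonDyer.BirchSwinnertonDyer.Theorems.SmallImageRttD2Seq

open Literature.NumberTheory.EllipticCurves Literature.NumberTheory.GaloisRepresentations Literature.NumberTheory.GaloisCohomology
  Literature.NumberTheory.EllipticCurves.GreenbergVatsal2000 Literature.NumberTheory.ComplexMultiplication.EllipticUnits.JohnsonLeungKings2011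
  Literature.NumberTheory.GaloisRepresentations.DiscreteGaloisModule
  Summit.BirchSwinnertonDyer.BirchSwinnertonDyer.Theorems.SmallImageCharSignedSelmer Summit.BirchSwinnertonDyer.BirchSwinnertonDyer.Theorems.SmallImageRttD2J1
open Literature.AnabelianGeometry.AbsoluteAnabelian.Prop121vii (zmodToQmodZ zmodToQmodZ_injective)

section RSeq

variable {K : Type} [Field K] [NumberField K] {p : ℕ} [Fact p.Prime] (S : Set (PadicAlgCl p)) (κ : ZpExtension K p)
  (θ' : absoluteGaloisGroup K →ₜ* (padicCoeffIntegers S)ˣ) (P : Set (HeightOneSpectrum (𝓞 K))) (v : HeightOneSpectrum (𝓞 K))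
  (M : Type) [AddCommGroup M] [TopologicalSpace M] [DiscreteTopology M] [DistribMulAction (absoluteGaloisGroup K) M]
  [Module (padicCoeffIntegers S) M]
  (hstabK : ∀ m : M, IsOpen (MulAction.stabilizer (absoluteGaloisGroup K) m : Set (absoluteGaloisGroup K)))

omit [NumberField K] in
/-- A bi-additive map vanishes when its first argument does (bookkeeping: lets a vanishing statement be supplied at the pairing's own argument type). [folklore] -/
theorem biadditive_apply_eq_zero_of_left {A B C : Type*} [AddCommGroup A] [AddCommGroup B] [AddCommGroup C] (f : A →+ B →+ C) {a : A} (b : B)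
    (h : a = 0) : f a b = 0 := by
  rw [h, map_zero, AddMonoidHom.zero_apply]

/-- **One orbit at a non-split place**: if `κ ∘ res_v` is onto (`AcSigned.IsNonsplitIn κ v`), then `ē_v : Γ_{K_v} ⧸ U_{n,v} → Γ_K ⧸ U_n` is onto for every layer `n`
(every coset of `U_n = κ⁻¹(pⁿℤ_p)` meets `res_v(Γ_{K_v})`). [cite: NeukirchSchmidtWingberg2008, I §5 (1.5.7)] -/
theorem quotientMapOfHom_surjective_of_isNonsplitIn (hv : AcSigned.IsNonsplitIn κ v) (n : ℕ) :
    Function.Surjective (quotientMapOfHom (κ.layerSubgroup n) (resGalOfEmb (closureEmb (K := K) (v.adicCompletion K)))) := by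
  refine quotientMapOfHom_surjective (κ.layerSubgroup n) _ fun g ↦ ?_
  obtain ⟨τ, hτ⟩ := hv (κ g)
  have hτ' : κ (resGalOfEmb (closureEmb (K := K) (v.adicCompletion K)) τ) = κ g := hτ
  refine ⟨τ, κ.kerSubgroup_le_layerSubgroup n ?_⟩
  rw [ZpExtension.mem_kerSubgroup, map_mul, map_inv, hτ', inv_mul_cancel]

omit [NumberField K] in
/-- A `k`-compatible family `(y_k)` (`red y_{k+1} = y_k`) is a `cycRedLE`-tower: `y_k = cycRedLE (k ≤ k′) y_{k′}`. [cite: Kato2004Asterisque, §8.2 (p. 180)] -/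
theorem eq_cycRedLE_of_forall_red (n : ℕ) (y : ∀ k : ℕ, cycLayerCohO S κ θ' P n k 1) (hy : ∀ k, cycLayerRedO S κ θ' P n k 1 (y (k + 1)) = y k)
    {k k' : ℕ} (h : k ≤ k') : y k = cycRedLE S κ θ' P 1 n h (y k') := by
  induction k', h using Nat.le_induction with
  | base => rw [cycRedLE_refl]
  | succ k' h ih => rw [← cycRedLE_trans S κ θ' P 1 n h (Nat.le_succ k'), cycRedLE_succ, hy, ih]

/-- ★★★ **`RSeq` — THE LEVELWISE POITOU–TATE RECIPROCITY of J3, PROVED for restricted global pairings.** Let `K` be totally complex, `v` the ONLY place of `K` above `p`,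
non-split in `K_∞/K` (`κ ∘ res_v` onto), `P ⊇` the ramification of `M` with `P ∖ S₀ ⊆ {v}` (`P`, `S₀` finite), `M` a discrete `p`-primary `Γ_K`-module with the
`Γ_{K_v}`-action `localAction` (restriction along `res_v`), and `PG_k : X_k × M[p^k] → μ_{p^k}` continuous `Γ_K`-equivariant pairings compatible with reduction/inclusion
(`hPred`). Then for every layer `n`, every `k`-compatible family `y_k ∈ H¹(G_P(K_n), X_k)` with all `y_k` S₀-STRICT, every `c ∈ Sel^{ε,S₀}_𝒪(K_n, M)` and every local
torsion-level lift `ℓ` of `loc_{v,n} c`: `⟨y_k, ℓ⟩_{n,k} = 0` for the layer pairings `locPairNK` of the restricted family `Pk k := PG_k|_{Γ_{K_v}}`. (The hypothesis `RSeq` of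
`exists_junction_exact_of_levelwiseSeq`, p791963, for this `Pk`.) [cite: NeukirchSchmidtWingberg2008, VIII §6] [cite: MilneADT2006, Ch. I, Thm. 4.10(b)]
[cite: Rubin2000, Thm. 1.7.3, §4.2] [cite: Kobayashi2003, Thm. 7.3 i)] [cite: Kato2004Asterisque, §17.13] -/
theorem locPairNK_eq_zero_of_globalPairing [IsTotallyComplex K] (V : WeierstrassCurve K) (j : V.geomPrimaryTorsion p →+ M) (S₀ : Set (HeightOneSpectrum (𝓞 K))) (ε : ℤˣ)
    (PG : ∀ k : ℕ, ContPairing (coeffRepK S θ' P k).toTopRep (torsRep M hstabK p k).toTopRep (mu K (p ^ k)).toTopRep)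
    (hPred : ∀ (k : ℕ) (x : ↥(Representation.invariants ((muTwistO S θ' (k + 1)).toRepresentation.comp (ramificationSubgroup K P).subtype))) (m : ↥(torsionPow M p k)),
      (PG (k + 1)).toLin x (AddSubgroup.inclusion (torsionPow_mono (M := M) (p := p) (Nat.le_succ k)) m) =
        muInclusion K (pow_dvd_pow p (Nat.le_succ k)) ((PG k).toLin (coeffMapO S P θ' (oMuRed S k) (oMuRed_muTwistO S θ' k) x) m))
    (htor : ∀ m : M, ∃ k : ℕ, p ^ k • m = 0) (hP : P.Finite) (hS₀ : S₀.Finite) (hPS₀ : ∀ w ∈ P, w ∉ S₀ → w = v)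
    (hpv : ∀ w : HeightOneSpectrum (𝓞 K), ((p : ℕ) : 𝓞 K) ∈ w.asIdeal → w = v)
    (hMP : ∀ w : HeightOneSpectrum (𝓞 K), w ∉ P → ∀ 𝔓 ∈ w.primesAbove, ∀ τ ∈ 𝔓.inertia (absoluteGaloisGroup K), ∀ m : M, τ • m = m)
    (hv : AcSigned.IsNonsplitIn κ v)
    (hstab : letI := localAction (closureEmb (K := K) (v.adicCompletion K)) M
      ∀ m : M, IsOpen (MulAction.stabilizer (absoluteGaloisGroup (v.adicCompletion K)) m : Set (absoluteGaloisGroup (v.adicCompletion K))))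
    (n : ℕ) (y : ∀ k : ℕ, cycLayerCohO S κ θ' P n k 1) (hyS : ∀ k, y k ∈ strictLevel S κ θ' P S₀ n k)
    (hyR : ∀ k, cycLayerRedO S κ θ' P n k 1 (y (k + 1)) = y k) (k : ℕ)
    (ℓ : letI := localAction (closureEmb (K := K) (v.adicCompletion K)) M
      subgroupH1 (localSubgroupOfEmb (κ.layerSubgroup n) (closureEmb (K := K) (v.adicCompletion K))) ↥(torsionPow M p k))
    (c : subgroupH1 (κ.layerSubgroup n) M) (hc : c ∈ signedTransportSelmerLayerSat κ M (padicCoeffIntegers S) V j S₀ ε n)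
    (hℓ : letI := localAction (closureEmb (K := K) (v.adicCompletion K)) M
      torsToH1 M p _ k ℓ = locH1Layer κ M v (fun _ _ ↦ rfl) n c) :
    letI := localAction (closureEmb (K := K) (v.adicCompletion K)) M
    locPairNK S κ θ' P v M hstab (fun k ↦ resPairingAt K (p ^ k) (coeffRepK S θ' P k) (torsRep M hstabK p k) (PG k) v) n k (y k) ℓ = 0 := by
  letI := localAction (closureEmb (K := K) (v.adicCompletion K)) M
  haveI : CompactSpace (absoluteGaloisGroup K) := absoluteGaloisGroup_compactSpace _
  haveI : ∀ w : HeightOneSpectrum (𝓞 K), CompactSpace (absoluteGaloisGroup (w.adicCompletion K)) := fun w ↦ absoluteGaloisGroup_compactSpace _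
  -- (1) LIFT: `torsIncl ℓ = θ^* b` for a global torsion-level lift `b` of `c`, after raising the level to `k'`
  obtain ⟨k', hk', b, hbc, hℓb⟩ := exists_torsIncl_eq_map_comapSubtypeHom κ v M hstabK htor n k c ℓ hℓ
  rw [eq_cycRedLE_of_forall_red S κ θ' P n y hyR hk',
    locPairNK_cycRedLE S κ θ' P v M hstab (fun k ↦ resPairingAt K (p ^ k) (coeffRepK S θ' P k) (torsRep M hstabK p k) (PG k) v)
      (fun k x m ↦ hPred k x m) n hk' (y k') ℓ, hℓb, locPairNK_apply, pairLoc_apply]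
  -- (2) it suffices that the layer pairing `inv_{U_{n,v}}(loc y_{k'} ∪ θ^* b)` vanishes in `ℤ/p^{k'}`
  haveI : NeZero (p ^ k') := ⟨pow_ne_zero _ (Fact.out : p.Prime).ne_zero⟩
  refine (map_eq_zero_iff (zmodToQmodZ (p ^ k')) (zmodToQmodZ_injective (p ^ k'))).mpr ?_
  -- (3) RECIPROCITY along the layer `K_n` for `a := infl_n y_{k'}` and `b`, `T := P ∪ S₀ ∪ {v}`
  haveI : DiscreteTopology (absoluteGaloisGroup K ⧸ κ.layerSubgroup n) := QuotientGroup.discreteTopology (κ.isOpen_layerSubgroup n)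
  haveI : Finite (absoluteGaloisGroup K ⧸ κ.layerSubgroup n) := finite_of_compact_of_discrete
  letI : Fintype (absoluteGaloisGroup K ⧸ κ.layerSubgroup n) := Fintype.ofFinite _
  haveI : ∀ w : HeightOneSpectrum (𝓞 K), IsClosed (localSubgroupOfEmb (κ.layerSubgroup n) (closureEmb (K := K) (w.adicCompletion K)) :
      Set (absoluteGaloisGroup (w.adicCompletion K))) := fun w ↦ isClosed_localLayer κ w n
  letI : ∀ w : HeightOneSpectrum (𝓞 K), Fintype (absoluteGaloisGroup (w.adicCompletion K) ⧸
      localSubgroupOfEmb (κ.layerSubgroup n) (closureEmb (K := K) (w.adicCompletion K))) := fun w ↦ fintypeQuotLocalLayer κ w n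
  set T : Finset (HeightOneSpectrum (𝓞 K)) := insert v (hP.toFinset ∪ hS₀.toFinset) with hT
  have hvT : v ∈ T := Finset.mem_insert_self _ _
  have hTP : ∀ w, w ∉ T → w ∉ P := fun w hw hwP ↦ hw (Finset.mem_insert_of_mem (Finset.mem_union_left _ (hP.mem_toFinset.mpr hwP)))
  have hTS : ∀ w, w ∉ T → w ∉ S₀ := fun w hw hwS ↦ hw (Finset.mem_insert_of_mem (Finset.mem_union_right _ (hS₀.mem_toFinset.mpr hwS)))
  have hTp : ∀ w, w ∉ T → ((p : ℕ) : 𝓞 K) ∉ w.asIdeal := fun w hw hwp ↦ hw (by rw [hpv w hwp]; exact hvT)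
  have hcur : torsToH1 M p (κ.layerSubgroup n) k' b ∈ unramifiedOutside (κ.layerSubgroup n) M p S₀ := by
    rw [hbc]; exact ((mem_signedTransportSelmerLayerSat_iff κ M (padicCoeffIntegers S) V j S₀ ε n c).mp hc).1
  have key := localPairingSubgroup_eq_zero_of_reciprocity K (p ^ k') (coeffRepK S θ' P k') (torsRep M hstabK p k') (PG k') (κ.layerSubgroup n) v
    (κ.isOpen_layerSubgroup n) ⟨k', rfl⟩ T hvT (quotientMapOfHom_surjective_of_isNonsplitIn κ v hv n) (inflNK S κ θ' P n k' (y k')) b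
    (fun w hw 𝔓 h𝔓 ↦ resLe_inf_inertia_inflNK_eq_zero S κ θ' P n k' (hTP w hw) h𝔓 (y k'))
    (fun w hw 𝔓 h𝔓 ↦ resLe_inf_inertia_eq_zero_of_torsToH1_mem_unramifiedOutside κ M hstabK n k' b hcur (hTS w hw) (hTp w hw) h𝔓 (hMP w (hTP w hw) 𝔓 h𝔓))
    (fun w hwT hwv g ↦ by
      -- `w ∈ T ∖ {v} ⊆ S₀`: the orbit term vanishes by S₀-strictness of `y_{k'}`
      have hwS : w ∈ S₀ := by
        rcases Finset.mem_insert.mp hwT with h | h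
        · exact absurd h hwv
        · rcases Finset.mem_union.mp h with h | h
          · by_contra hwS; exact hwv (hPS₀ w (hP.mem_toFinset.mp h) hwS)
          · exact hS₀.mem_toFinset.mp h
      refine biadditive_apply_eq_zero_of_left _ _ ?_
      rw [conjMap_inflNK, map_comapSubtypeHom_inflNK]
      exact locNK_conj_eq_zero_of_mem_strictLevel S κ θ' P S₀ (hyS k') hwS g)
  rw [map_comapSubtypeHom_inflNK] at key
  exact key

end RSeq

end Summit.BirchSwinnertonDyer.BirchSwinnertonDyer.Theorems.SmallImageRttD2Seq

end
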